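import Literature.Probability.RandomPlanarGeometry.USTPeanoPeeling
import HarnessLib

/-!
# Peeling off the first vertex: every good peeling data has a Peano path ([LSW04] §4.1)

The combinatorial heart of the existence of UST Peano paths (G. F. Lawler, O. Schramm,
W. Werner, Ann. Probab. **32** (2004), §4.1, pp. 971–972; their bijection `T ↦ γ(T)` shows in
particular that the set of Peano paths of `D ∈ 𝔇*` is nonempty). For peeling data `S`
(`USTPeanoPeeling.lean`) satisfying the axioms `Good` we construct a Peano path
(`PeelData.Good.exists_isPath`) by strong induction on `|V|`, following the Markov structure of
[LSW04] Lemma 4.1: the first edge of the path goes from `a` to one of its two out-neighbours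
`t`, and the rest is a Peano path of the peeled data `D(α₁, β₁, t, b)` where the wall has been
extended by the lattice edge alongside the first edge (`PeelData.peelE`):

* `PeelData.CanE S` — the dual step `a → stepD a` is available: the dual edge it crosses is not
  in `β`, and the primal edge `f₁ = [α_a, farP a]` alongside it can be added to `α` keeping it a
  simple path from the new primal neighbour `farP a` (i.e. `farP a ∉ α`), or IS the first edge of
  `α` (then it is dropped, `α₁ = α.tail`);
* `PeelData.Good.peelE` — the peeled data is good (the in-neighbours of `stepD a` are `a` and the
  co-source `coSrc a`, whose edge to `stepD a` crosses `f₁`; in the dropping case `coSrc a ∉ V`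
  because the clockwise face walk `coSrc a → stepP a → ⋯ → a` is unblocked);
* `PeelData.Good.eq_empty_of_stepD_eq` — if the available step leads to `b` then `V = ∅`
  (escape lemma);
* `PeelData.Good.canE_or` — the dual step of `S` or the dual step of the exchanged data `S.swap`
  (= the primal step of `S`) is available: otherwise `farP a ∈ α`, `farD a ∈ β` and the closed
  primal walk `α_a … farP a, α_a` meets the closed dual walk `β_a … farD a, β_a` in exactly ONE dual
  pair (`f₁`, `f₂`), contradicting the parity lemma `crossings_mod_two`;
* `PeelData.Good.exists_isPath` — the theorem.
-/

namespace Literature.Probability.RandomPlanarGeometry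

namespace USTPeano

/-- The head of a duplicate-free list is not in its tail. [folklore] -/
theorem head_notMem_tail {X : Type*} {l : List X} (hl : l ≠ []) (hnd : l.Nodup) :
    l.head hl ∉ l.tail := by
  obtain ⟨x, t, rfl⟩ := List.exists_cons_of_ne_nil hl
  exact (List.nodup_cons.1 hnd).1

/-- The consecutive pairs of `x :: l`: the first edge and the pairs of `l`. [folklore] -/
theorem mem_zip_cons_iff {X : Type*} (x : X) (l : List X) (hl : l ≠ []) (e : X × X) :
    e ∈ (x :: l).zip (x :: l).tail ↔ e = (x, l.head hl) ∨ e ∈ l.zip l.tail := by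
  obtain ⟨y, t, rfl⟩ := List.exists_cons_of_ne_nil hl
  rw [zip_tail_cons_cons, List.mem_cons, List.head_cons]

/-- `swapIdx` twice on a list. [folklore] -/
theorem map_swapIdx_map_swapIdx (l : List (ℤ × ℤ)) : (l.map swapIdx).map swapIdx = l := by
  rw [List.map_map]
  conv_rhs => rw [← List.map_id l]
  exact List.map_congr_left fun x _ ↦ swapIdx_swapIdx x

namespace PeelData

variable (S : PeelData)

/-! ### The peeled data -/

/-- **The dual step is available**: the dual edge crossed by `a → stepD a` is not a wall, and
the primal edge `[α_a, farP a]` alongside can be added to the simple path `α` (`farP a ∉ α`) or is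
its first edge. [cite: LawlerSchrammWerner2004, Lemma 4.1] -/
def CanE (S : PeelData) : Prop :=
  s(dualNbr S.a, farD S.a) ∉ edgeSet S.β ∧ (farP S.a ∉ S.α ∨ ∃ t, S.α = primalNbr S.a :: farP S.a :: t)

/-- **Peeling off the first vertex along the dual step** ([LSW04] Lemma 4.1 with `n = 1`:
`D₁ = D(α₁, β₁, γ(1), b)`, `α₁ = α ∪ [v₀, v₁]`): the new initial vertex is `stepD a`, it is removed
from `V`, and the primal wall becomes `farP a :: α` — or `α.tail` when `[α_a, farP a]` already is
the first edge of `α` (the dangling edge is dropped; it borders no remaining vertex).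
[cite: LawlerSchrammWerner2004, Lemma 4.1] -/
def peelE : PeelData where
  V := S.V.erase (stepD S.a)
  α := if farP S.a ∈ S.α then S.α.tail else farP S.a :: S.α
  β := S.β
  a := stepD S.a
  b := S.b

/-- Components of the peeled data. [folklore] -/
@[simp] theorem peelE_V : S.peelE.V = S.V.erase (stepD S.a) := rfl

/-- Components of the peeled data. [folklore] -/
@[simp] theorem peelE_β : S.peelE.β = S.β := rfl

/-- Components of the peeled data. [folklore] -/
@[simp] theorem peelE_a : S.peelE.a = stepD S.a := rfl

/-- Components of the peeled data. [folklore] -/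
@[simp] theorem peelE_b : S.peelE.b = S.b := rfl

variable {S}

/-- The primal wall of the peeled data, prepend case. [folklore] -/
theorem peelE_α_of_notMem (hn : farP S.a ∉ S.α) : S.peelE.α = farP S.a :: S.α := by
  simp [peelE, hn]

/-- The primal wall of the peeled data, dropping case. [folklore] -/
theorem peelE_α_of_eq {t : List (ℤ × ℤ)} (ht : S.α = primalNbr S.a :: farP S.a :: t) :
    S.peelE.α = farP S.a :: t := by
  simp [peelE, ht]

/-- The primal wall starts at `α_a`. [folklore] -/
theorem Good.α_eq_cons (h : S.Good) : ∃ l, S.α = primalNbr S.a :: l := by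
  obtain ⟨x, l, hα⟩ := List.exists_cons_of_ne_nil h.α_ne
  refine ⟨l, ?_⟩
  have h1 : S.α.head? = some (primalNbr S.a) := by rw [List.head?_eq_some_head h.α_ne, h.headα]
  rw [hα] at h1 ⊢
  simp only [List.head?_cons, Option.some.injEq] at h1
  rw [h1]

/-- The dual wall starts at `β_a`. [folklore] -/
theorem Good.β_eq_cons (h : S.Good) : ∃ l, S.β = dualNbr S.a :: l := by
  obtain ⟨x, l, hβ⟩ := List.exists_cons_of_ne_nil h.β_ne
  refine ⟨l, ?_⟩
  have h1 : S.β.head? = some (dualNbr S.a) := by rw [List.head?_eq_some_head h.β_ne, h.headβ]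
  rw [hβ] at h1 ⊢
  simp only [List.head?_cons, Option.some.injEq] at h1
  rw [h1]

section Peel

/-- The edges of the new primal wall are the old ones, up to `f₁`. [folklore] -/
theorem Good.mem_edgeSet_peelE_iff (h : S.Good) (hE : S.CanE) {e : Sym2 (ℤ × ℤ)} (he : e ≠ s(primalNbr S.a, farP S.a)) :
    e ∈ edgeSet S.peelE.α ↔ e ∈ edgeSet S.α := by
  rcases hE.2 with hn | ⟨t, ht⟩
  · obtain ⟨l, hα⟩ := h.α_eq_cons
    rw [peelE_α_of_notMem hn, hα, edgeSet_cons_cons, List.mem_cons]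
    have he' : e ≠ s(farP S.a, primalNbr S.a) := by rwa [Sym2.eq_swap]
    simp [he']
  · rw [peelE_α_of_eq ht, ht, edgeSet_cons_cons, List.mem_cons]
    simp [he]

/-- Blocked edges of the peeled data are the old ones, except from `a` and `coSrc a`.
[folklore] -/
theorem Good.blocked_peelE_iff (h : S.Good) (hE : S.CanE) {p q : ℤ × ℤ}
    (hne : s(primalNbr p, farP p) ≠ s(primalNbr S.a, farP S.a)) :
    S.peelE.Blocked p q ↔ S.Blocked p q := by
  simp only [Blocked, h.mem_edgeSet_peelE_iff hE hne, peelE_β]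

/-- The new initial vertex lies in `V` (unless it is `b`). [folklore] -/
theorem Good.stepD_mem_V (h : S.Good) (hE : S.CanE) (hb : stepD S.a ≠ S.b) : stepD S.a ∈ S.V :=
  (h.stepD_mem hE.1).resolve_left hb

/-- In the dropping case, a vertex with primal neighbour `α_a` is not `b`. [folklore] -/
theorem Good.ne_b_of_primalNbr_eq (h : S.Good) {t : List (ℤ × ℤ)} (ht : S.α = primalNbr S.a :: farP S.a :: t)
    {p : ℤ × ℤ} (hp : primalNbr p = primalNbr S.a) : p ≠ S.b := by
  rintro rfl
  have hl := h.lastα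
  have hnd := h.nodupα
  rw [← hp] at ht
  simp only [ht, List.getLast_cons (List.cons_ne_nil _ t)] at hl
  rw [ht] at hnd
  exact (List.nodup_cons.1 hnd).1 (hl ▸ List.getLast_mem _)

/-- In the dropping case, the face walk around `α_a` is unblocked: a vertex of `V` on the face
whose spoke is not `f₁` steps within `V`. [folklore] -/
theorem Good.stepP_mem_V_of (h : S.Good) {t : List (ℤ × ℤ)} (ht : S.α = primalNbr S.a :: farP S.a :: t)
    {c : ℤ × ℤ} (hc : c ∈ S.V) (hpn : primalNbr c = primalNbr S.a) (hfar : farP c ≠ farP S.a) :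
    stepP c ∈ S.V := by
  have hub : ¬ S.Blocked c (stepP c) := by
    rw [blocked_stepP_iff, hpn, mem_edgeSet_head_iff h.α_ne h.nodupα h.headα]
    rintro ⟨t', ht'⟩
    rw [ht] at ht'
    simp only [List.cons.injEq, true_and] at ht'
    exact hfar ht'.1.symm
  rcases h.closed c (Or.inr hc) _ (manhattan_stepP c) hub with hb | hV
  · exact absurd hb (h.ne_b_of_primalNbr_eq ht (by rw [primalNbr_stepP, hpn]))
  · exact hV

/-- **In the dropping case the co-source is outside**: otherwise the clockwise face walk
`coSrc a → stepP a → stepP² a → stepP³ a → a` (crossing `f₂`, then the three spokes of `α_a`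
other than `f₁`, none of them a wall) would put `a` in `V`. [folklore] -/
theorem Good.coSrc_notMem (h : S.Good) (hE : S.CanE) {t : List (ℤ × ℤ)} (ht : S.α = primalNbr S.a :: farP S.a :: t) :
    coSrc S.a ∉ S.V := by
  intro hc
  -- step 0: across `f₂`
  have hub : ¬ S.Blocked (coSrc S.a) (stepP S.a) := by
    rw [← stepD_coSrc, blocked_stepD_iff, dualNbr_coSrc, farD_coSrc, Sym2.eq_swap]
    exact hE.1
  have h1 : stepP S.a ∈ S.V := by
    rcases h.closed _ (Or.inr hc) _ (by rw [← stepD_coSrc]; exact manhattan_stepD _) hub with hb | hV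
    · exact absurd hb (h.ne_b_of_primalNbr_eq ht (primalNbr_stepP _))
    · exact hV
  -- steps 1–3 around the face
  have hf := farP_stepP_ne S.a
  have h2 := h.stepP_mem_V_of ht h1 (primalNbr_stepP _) hf.1
  have h3 := h.stepP_mem_V_of ht h2 (by rw [primalNbr_stepP, primalNbr_stepP]) hf.2.1
  have h4 := h.stepP_mem_V_of ht h3
    (by rw [primalNbr_stepP, primalNbr_stepP, primalNbr_stepP]) hf.2.2
  rw [stepP_stepP_stepP_stepP] at h4
  exact h.a_notMem h4

/-- **The peeled data is good.** [cite: LawlerSchrammWerner2004, Lemma 4.1] -/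
theorem Good.peelE (h : S.Good) (hE : S.CanE) (hb : stepD S.a ≠ S.b) : S.peelE.Good := by
  have haV := h.stepD_mem_V hE hb
  -- the two shapes of the new primal wall
  have hshape : (farP S.a ∉ S.α ∧ S.peelE.α = farP S.a :: S.α) ∨
      ∃ t, S.α = primalNbr S.a :: farP S.a :: t ∧ S.peelE.α = farP S.a :: t := by
    rcases hE.2 with hn | ⟨t, ht⟩
    · exact Or.inl ⟨hn, peelE_α_of_notMem hn⟩
    · exact Or.inr ⟨t, ht, peelE_α_of_eq ht⟩
  have hα_ne : S.peelE.α ≠ [] := by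
    rcases hshape with ⟨-, e⟩ | ⟨t, -, e⟩ <;> simp [e]
  refine
    { α_ne := hα_ne
      β_ne := h.β_ne
      chainα := ?_
      chainβ := h.chainβ
      headα := ?_
      headβ := by
        show S.β.head h.β_ne = dualNbr (stepD S.a)
        rw [dualNbr_stepD]; exact h.headβ
      lastα := ?_
      lastβ := h.lastβ
      nodupα := ?_
      nodupβ := h.nodupβ
      a_ne_b := hb
      a_notMem := Finset.notMem_erase _ _
      b_notMem := fun hb' ↦ h.b_notMem (Finset.mem_of_mem_erase hb')
      nocross := ?_
      closed := ?_ }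
  · -- chainα
    rcases hshape with ⟨-, e⟩ | ⟨t, ht, e⟩
    · rw [e]
      exact List.IsChain.cons_of_ne_nil h.α_ne h.chainα
        (by rw [h.headα]; exact (latticeAdj_primalNbr_farP _).symm)
    · have := h.chainα
      rw [ht] at this
      rw [e]
      exact this.tail
  · -- headα
    rcases hshape with ⟨-, e⟩ | ⟨t, -, e⟩ <;> simp [e, farP]
  · -- lastα
    rcases hshape with ⟨-, e⟩ | ⟨t, ht, e⟩
    · simp only [e, List.getLast_cons h.α_ne, peelE_b]
      exact h.lastα
    · have hl := h.lastα
      simp only [ht, List.getLast_cons (List.cons_ne_nil _ t)] at hl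
      simp only [e, peelE_b]
      exact hl
  · -- nodupα
    rcases hshape with ⟨hn, e⟩ | ⟨t, ht, e⟩
    · rw [e]; exact List.nodup_cons.2 ⟨hn, h.nodupα⟩
    · have := h.nodupα
      rw [ht] at this
      rw [e]; exact (List.nodup_cons.1 this).2
  · -- nocross
    intro e' he' f hf
    have hfβ : s(f.1, f.2) ∈ edgeSet S.β := List.mem_map_of_mem hf
    rcases hshape with ⟨-, e⟩ | ⟨t, ht, e⟩
    · rw [e] at he'
      obtain ⟨l, hα⟩ := h.α_eq_cons
      rw [hα, zip_tail_cons_cons, List.mem_cons] at he'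
      rcases he' with rfl | he'
      · intro hd
        exact hE.1 (hd.symm_left.eq_of_primal ▸ hfβ)
      · exact h.nocross e' (hα ▸ he') f hf
    · refine h.nocross e' ?_ f hf
      rw [ht, zip_tail_cons_cons]
      rw [e] at he'
      exact List.mem_cons_of_mem _ he'
  · -- closed
    intro p hp q hm hbl
    simp only [peelE_a, peelE_V, Finset.mem_erase] at hp
    have hpV : p ∈ S.V := by
      rcases hp with rfl | ⟨-, hp⟩
      · exact haV
      · exact hp
    have hpa : p ≠ S.a := fun e ↦ h.a_notMem (e ▸ hpV)
    simp only [peelE_b, peelE_V, Finset.mem_erase]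
    by_cases hf1 : s(primalNbr p, farP p) = s(primalNbr S.a, farP S.a)
    · -- `p = coSrc a`
      have hpc : p = coSrc S.a := (eq_or_eq_coSrc_of_farP hf1).resolve_left hpa
      subst hpc
      rcases hshape with ⟨hn, e⟩ | ⟨t, ht, -⟩
      · -- prepend case: the primal step of `coSrc a` is now blocked, the dual one is as before
        rcases (manhattan_iff_step _ _).1 hm with rfl | rfl
        · -- dual step: to `stepP a`
          have hub : ¬ S.Blocked (coSrc S.a) (stepD (coSrc S.a)) := by
            rw [blocked_stepD_iff]; rwa [blocked_stepD_iff] at hbl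
          rcases h.closed _ (Or.inr hpV) _ (manhattan_stepD _) hub with h1 | h1
          · exact Or.inl h1
          · refine Or.inr ⟨?_, h1⟩
            rw [stepD_coSrc]
            exact (stepD_ne_stepP _).symm
        · exfalso
          refine hbl (Or.inl ⟨rfl, ?_⟩)
          obtain ⟨l, hα⟩ := h.α_eq_cons
          rw [primalNbr_coSrc, farP_coSrc, e, hα, edgeSet_cons_cons]
          exact List.mem_cons_self
      · exact absurd hpV (h.coSrc_notMem hE ht)
    · rw [h.blocked_peelE_iff hE hf1] at hbl
      rcases h.closed p (Or.inr hpV) q hm hbl with h1 | h1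
      · exact Or.inl h1
      · refine Or.inr ⟨?_, h1⟩
        rintro rfl
        rcases (manhattan_to_stepD_iff _ _).1 hm with rfl | rfl
        · exact hpa rfl
        · exact hf1 (by rw [primalNbr_coSrc, farP_coSrc, Sym2.eq_swap])

/-- The number of interior vertices drops. [folklore] -/
theorem Good.card_peelE_lt (h : S.Good) (hE : S.CanE) (hb : stepD S.a ≠ S.b) : S.peelE.V.card < S.V.card :=
  Finset.card_erase_lt_of_mem (h.stepD_mem_V hE hb)

/-- **Prepending `a`**: a Peano path of the peeled data extends to a Peano path.
[cite: LawlerSchrammWerner2004, Lemma 4.1] -/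
theorem IsPath.cons_peelE (h : S.Good) (hE : S.CanE) (hb : stepD S.a ≠ S.b) {l : List (ℤ × ℤ)} (hl : S.peelE.IsPath l) :
    S.IsPath (S.a :: l) := by
  have haV := h.stepD_mem_V hE hb
  have hhead : l.head hl.ne_nil = stepD S.a := hl.head_eq
  have ha : S.a ∉ l := by
    intro ha
    rcases (hl.mem_iff S.a).1 ha with h1 | h1 | h1
    · exact stepD_ne_self _ h1.symm
    · exact h.a_ne_b h1
    · exact h.a_notMem (Finset.mem_of_mem_erase h1)
  refine
    { ne_nil := List.cons_ne_nil _ _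
      head_eq := rfl
      getLast_eq := by rw [List.getLast_cons hl.ne_nil]; exact hl.getLast_eq
      isChain := List.IsChain.cons_of_ne_nil hl.ne_nil hl.isChain
        (by rw [hhead]; exact manhattan_stepD _)
      nodup := List.nodup_cons.2 ⟨ha, hl.nodup⟩
      mem_iff := fun p ↦ ?_
      unblocked := ?_ }
  · rw [List.mem_cons, hl.mem_iff p]
    simp only [peelE_a, peelE_b, peelE_V, Finset.mem_erase]
    constructor
    · rintro (h1 | h1 | h1 | ⟨-, h1⟩)
      · exact Or.inl h1
      · exact Or.inr (Or.inr (h1 ▸ haV))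
      · exact Or.inr (Or.inl h1)
      · exact Or.inr (Or.inr h1)
    · rintro (h1 | h1 | h1)
      · exact Or.inl h1
      · exact Or.inr (Or.inr (Or.inl h1))
      · by_cases hp : p = stepD S.a
        · exact Or.inr (Or.inl hp)
        · exact Or.inr (Or.inr (Or.inr ⟨hp, h1⟩))
  · intro e he
    rcases (mem_zip_cons_iff S.a l hl.ne_nil e).1 he with rfl | he
    · rw [hhead, blocked_stepD_iff]
      exact hE.1
    · have hub := hl.unblocked e he
      by_cases hf1 : s(primalNbr e.1, farP e.1) = s(primalNbr S.a, farP S.a)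
      · -- `e.1 = coSrc a`; its blocked primal step would end at the head `stepD a` of `l`
        have he1 : e.1 ∈ l := (List.of_mem_zip he).1
        have he2 : e.2 ∈ l.tail := (List.of_mem_zip he).2
        have hpa : e.1 ≠ S.a := fun h1 ↦ ha (h1 ▸ he1)
        have hpc : e.1 = coSrc S.a := (eq_or_eq_coSrc_of_farP hf1).resolve_left hpa
        rintro (⟨hq, -⟩ | ⟨hq, hm⟩)
        · rw [hpc, stepP_coSrc] at hq
          rw [hq] at he2
          exact head_notMem_tail hl.ne_nil hl.nodup (hhead ▸ he2)
        · rw [hpc, dualNbr_coSrc, farD_coSrc, Sym2.eq_swap] at hm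
          exact hE.1 hm
      · rwa [h.blocked_peelE_iff hE hf1] at hub

/-- **If the available dual step ends at `b`, there is no interior vertex.** Then
`α = [α_a, α_b]`, `β = [β_a]`, so the only blocked edges cross `f₁`; both steps from every vertex of
`V` stay in `V ∪ {b}` and the escape lemma applies. [folklore] -/
theorem Good.eq_empty_of_stepD_eq (h : S.Good) (hE : S.CanE) (hb : stepD S.a = S.b) : S.V = ∅ := by
  -- `α = [α_a, farP a]`
  have hfar : farP S.a ∈ S.α := by
    have : farP S.a = S.α.getLast h.α_ne := by rw [h.lastα, ← hb]; rfl
    rw [this]; exact List.getLast_mem _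
  obtain ⟨t, ht⟩ : ∃ t, S.α = primalNbr S.a :: farP S.a :: t := hE.2.resolve_left (fun hn ↦ hn hfar)
  have ht0 : t = [] := by
    have hl := h.lastα
    have hnd := h.nodupα
    rw [← hb] at hl
    simp only [ht] at hl hnd
    exact eq_nil_of_getLast_eq hnd hl
  subst ht0
  -- `β = [β_a]`
  have hβ : S.β = [S.β.head h.β_ne] :=
    eq_singleton_of_head_eq_getLast h.β_ne h.nodupβ (by rw [h.headβ, h.lastβ, ← hb, dualNbr_stepD])
  have hEβ : edgeSet S.β = [] := by rw [hβ]; rfl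
  have hEα : edgeSet S.α = [s(primalNbr S.a, farP S.a)] := by rw [ht]; rfl
  refine eq_empty_of_forall_step_mem S.V S.b h.b_notMem fun p hp ↦ ?_
  have hpa : p ≠ S.a := fun e ↦ h.a_notMem (e ▸ hp)
  have hD : stepD p ∈ insert S.b S.V := by
    rw [Finset.mem_insert]
    exact h.closed p (Or.inr hp) _ (manhattan_stepD p) (by rw [blocked_stepD_iff, hEβ]; simp)
  have hP : stepP p ∈ insert S.b S.V := by
    rw [Finset.mem_insert]
    by_cases hbl : S.Blocked p (stepP p)
    · rw [blocked_stepP_iff, hEα, List.mem_singleton] at hbl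
      have hpc : p = coSrc S.a := (eq_or_eq_coSrc_of_farP hbl).resolve_left hpa
      left
      rw [hpc, stepP_coSrc, hb]
    · exact h.closed p (Or.inr hp) _ (manhattan_stepP p) hbl
  rcases hStep_eq_or p with ⟨h1, h2⟩ | ⟨h1, h2⟩
  · exact ⟨h1 ▸ hD, h2 ▸ hP⟩
  · exact ⟨h1 ▸ hP, h2 ▸ hD⟩

end Peel

/-! ### Neither step available: the parity contradiction -/

section Parity

/-- The availability of the primal step, read through the exchange. [folklore] -/
theorem canE_swap_iff : S.swap.CanE ↔
    (s(primalNbr S.a, farP S.a) ∉ edgeSet S.α ∧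
      (farD S.a ∉ S.β ∨ ∃ t, S.β = dualNbr S.a :: farD S.a :: t)) := by
  simp only [CanE, swap_a, swap_α, swap_β, dualNbr_swapIdx, farD_swapIdx, primalNbr_swapIdx,
    farP_swapIdx, mem_edgeSet_map_swapIdx, List.mem_map_of_injective swapIdx_injective]
  refine and_congr Iff.rfl (or_congr Iff.rfl ⟨?_, ?_⟩)
  · rintro ⟨t, ht⟩
    refine ⟨t.map swapIdx, ?_⟩
    have := congrArg (List.map swapIdx) ht
    rw [map_swapIdx_map_swapIdx] at this
    simpa using this
  · rintro ⟨t, ht⟩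
    exact ⟨t.map swapIdx, by simp [ht]⟩

/-- **One crossing.** If `farP a ∈ α`, `farD a ∈ β` while `f₁ ∉ α`, `f₂ ∉ β`, the closed primal walk
`α_a, …, farP a, α_a` and the closed dual walk `β_a, …, farD a, β_a` have exactly one mutually dual pair
of edges, `(f₁, f₂)` — which the parity lemma forbids. [folklore] -/
theorem Good.false_of_mem_of_mem (h : S.Good) (hPα : farP S.a ∈ S.α) (hDβ : farD S.a ∈ S.β)
    (h1 : s(primalNbr S.a, farP S.a) ∉ edgeSet S.α) (h2 : s(dualNbr S.a, farD S.a) ∉ edgeSet S.β) :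
    False := by
  obtain ⟨l₁, l₂, hα⟩ := List.append_of_mem hPα
  obtain ⟨m₁, m₂, hβ⟩ := List.append_of_mem hDβ
  set P := l₁ ++ [farP S.a] with hP
  set Q := m₁ ++ [farD S.a] with hQ
  have hαP : S.α = P ++ l₂ := by rw [hα, hP, List.append_assoc, List.singleton_append]
  have hβQ : S.β = Q ++ m₂ := by rw [hβ, hQ, List.append_assoc, List.singleton_append]
  have hPne : P ≠ [] := by simp [hP]
  have hQne : Q ≠ [] := by simp [hQ]
  have hPlast : P.getLast hPne = farP S.a := by simp [hP]
  have hQlast : Q.getLast hQne = farD S.a := by simp [hQ]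
  have hPhead : P.head hPne = primalNbr S.a := by
    rw [← h.headα]
    simp only [hαP]
    exact (List.head_append_left hPne).symm
  have hQhead : Q.head hQne = dualNbr S.a := by
    rw [← h.headβ]
    simp only [hβQ]
    exact (List.head_append_left hQne).symm
  -- the closed walks
  set A := P ++ [primalNbr S.a] with hA
  set B := Q ++ [dualNbr S.a] with hB
  have hAne : A ≠ [] := by simp [hA]
  have hBne : B ≠ [] := by simp [hB]
  have hAc : A.IsChain LatticeAdj := by
    refine List.IsChain.append (h.chainα |> fun hc ↦ (hαP ▸ hc).left_of_append)
      (List.isChain_singleton _) ?_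
    intro x hx y hy
    rw [List.getLast?_eq_getLast_of_ne_nil hPne, Option.mem_def, Option.some.injEq] at hx
    simp only [List.head?_cons, Option.mem_def, Option.some.injEq] at hy
    subst hx; subst hy
    rw [hPlast]
    exact (latticeAdj_primalNbr_farP _).symm
  have hBc : B.IsChain LatticeAdj := by
    refine List.IsChain.append (h.chainβ |> fun hc ↦ (hβQ ▸ hc).left_of_append)
      (List.isChain_singleton _) ?_
    intro x hx y hy
    rw [List.getLast?_eq_getLast_of_ne_nil hQne, Option.mem_def, Option.some.injEq] at hx
    simp only [List.head?_cons, Option.mem_def, Option.some.injEq] at hy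
    subst hx; subst hy
    rw [hQlast]
    exact (latticeAdj_dualNbr_farD _).symm
  have hAcl : A.head hAne = A.getLast hAne := by
    simp only [hA, List.getLast_append_singleton]
    rw [List.head_append_left hPne, hPhead]
  have hBcl : B.head hBne = B.getLast hBne := by
    simp only [hB, List.getLast_append_singleton]
    rw [List.head_append_left hQne, hQhead]
  have hpar := crossings_mod_two hAne hAc hAcl hBne hBc hBcl
  -- compute the crossings: exactly one
  have hPsub : ∀ e ∈ P.zip P.tail, e ∈ S.α.zip S.α.tail := fun e he ↦
    hαP ▸ (zip_tail_sublist_append P l₂).subset he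
  have hQsub : ∀ f ∈ Q.zip Q.tail, f ∈ S.β.zip S.β.tail := fun f hf ↦
    hβQ ▸ (zip_tail_sublist_append Q m₂).subset hf
  have hone : crossings A B = 1 := by
    unfold crossings
    rw [hA, hB, zip_tail_append_singleton P hPne, zip_tail_append_singleton Q hQne, hPlast, hQlast]
    simp only [List.map_append, List.map_cons, List.map_nil, List.sum_append, List.sum_cons,
      List.sum_nil, add_zero]
    -- the edges of `P` cross nothing
    have hT1 : ((P.zip P.tail).map fun e ↦
        (((Q.zip Q.tail).map fun f ↦ if IsDualPair e.1 e.2 f.1 f.2 then (1 : ℤ) else 0).sum +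
          if IsDualPair e.1 e.2 (farD S.a) (dualNbr S.a) then (1 : ℤ) else 0)).sum = 0 := by
      refine sum_map_eq_zero_of_forall _ _ fun e he ↦ ?_
      have hz : ((Q.zip Q.tail).map fun f ↦ if IsDualPair e.1 e.2 f.1 f.2 then (1 : ℤ) else 0).sum =
          0 :=
        sum_map_eq_zero_of_forall _ _ fun f hf ↦ if_neg (h.nocross e (hPsub e he) f (hQsub f hf))
      rw [hz, zero_add, if_neg]
      intro hd
      exact h1 (hd.symm_right.eq_of_dual ▸ List.mem_map_of_mem (hPsub e he))
    -- the closing edge `f₁` crosses only `f₂`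
    have hT2 : ((Q.zip Q.tail).map fun f ↦
        if IsDualPair (farP S.a) (primalNbr S.a) f.1 f.2 then (1 : ℤ) else 0).sum = 0 := by
      refine sum_map_eq_zero_of_forall _ _ fun f hf ↦ if_neg fun hd ↦ ?_
      exact h2 (hd.symm_left.eq_of_primal ▸ List.mem_map_of_mem (hQsub f hf))
    rw [hT1, hT2, if_pos (isDualPair_far S.a).symm_left.symm_right]
    norm_num
  rw [hone] at hpar
  norm_num at hpar

/-- **One of the two steps is available**: either the dual step of `S` or the dual step of the
exchanged data (the primal step of `S`). [folklore] -/
theorem Good.canE_or (h : S.Good) : S.CanE ∨ S.swap.CanE := by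
  by_contra hc
  rw [not_or, canE_swap_iff] at hc
  obtain ⟨hc1, hc2⟩ := hc
  simp only [CanE, not_and_or, not_or, not_not, not_exists] at hc1 hc2
  have hheadα := mem_edgeSet_head_iff (y := farP S.a) h.α_ne h.nodupα h.headα
  have hheadβ := mem_edgeSet_head_iff (y := farD S.a) h.β_ne h.nodupβ h.headβ
  rcases hc1 with hD | ⟨hPα, hnα⟩
  · -- `f₂ ∈ β`: then `β` starts with it, so the primal step is unavailable only if `f₁ ∈ α`
    rcases hc2 with hP | ⟨-, hnβ⟩
    · exact h.not_both_mem S.a ⟨hP, hD⟩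
    · obtain ⟨t, ht⟩ := hheadβ.1 hD
      exact hnβ t ht
  · have hnα' : s(primalNbr S.a, farP S.a) ∉ edgeSet S.α := fun hm ↦ by
      obtain ⟨t, ht⟩ := hheadα.1 hm
      exact hnα t ht
    rcases hc2 with hP | ⟨hDβ, hnβ⟩
    · exact hnα' hP
    · have hnβ' : s(dualNbr S.a, farD S.a) ∉ edgeSet S.β := fun hm ↦ by
        obtain ⟨t, ht⟩ := hheadβ.1 hm
        exact hnβ t ht
      exact h.false_of_mem_of_mem hPα hDβ hnα' hnβ'

end Parity

/-! ### The theorem -/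

/-- One induction step along an available dual step. [folklore] -/
theorem Good.exists_isPath_of_canE (h : S.Good) (hE : S.CanE) (hV : S.V ≠ ∅)
    (IH : ∀ S' : PeelData, S'.Good → S'.V.card < S.V.card → ∃ l, S'.IsPath l) :
    ∃ l, S.IsPath l := by
  have hb : stepD S.a ≠ S.b := fun hb ↦ hV (h.eq_empty_of_stepD_eq hE hb)
  obtain ⟨l, hl⟩ := IH S.peelE (h.peelE hE hb) (h.card_peelE_lt hE hb)
  exact ⟨_, IsPath.cons_peelE h hE hb hl⟩

/-- **Every good peeling data has a Peano path** — the combinatorial form of [LSW04] §4.1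
("`T ↦ γ(T)` is a bijection between the set of spanning trees of `H` containing `α` and the set of
oriented paths in `G⃗ ∩ D̄` from `a` to `b` containing `V_P`"; in particular the latter set is
nonempty). By strong induction on `|V|`: base case `V = ∅`; otherwise peel off the first vertex
along the available step (`canE_or`), exchanging primal and dual if necessary.
[cite: LawlerSchrammWerner2004, §4.1] -/
theorem Good.exists_isPath (h : S.Good) : ∃ l, S.IsPath l := by
  induction hn : S.V.card using Nat.strong_induction_on generalizing S with
  | _ n IH =>
    by_cases hV : S.V = ∅
    · exact h.exists_isPath_of_empty hV
    rcases h.canE_or with hE | hE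
    · exact h.exists_isPath_of_canE hE hV fun S' h' hc ↦ IH _ (hn ▸ hc) h' rfl
    · have hV' : S.swap.V ≠ ∅ := by
        intro h0
        apply hV
        rw [← Finset.card_eq_zero, ← card_swap_V, h0, Finset.card_empty]
      obtain ⟨l, hl⟩ := h.swap.exists_isPath_of_canE hE hV' fun S' h' hc ↦
        IH _ (by rw [card_swap_V] at hc; exact hn ▸ hc) h' rfl
      exact ⟨_, hl.of_swap⟩

end PeelData

end USTPeano

end Literature.Probability.RandomPlanarGeometry
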